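import Summits.RiemannHypothesis.RiemannHypothesis.Theses.SignCone
import Summits.RiemannHypothesis.RiemannHypothesis.Theorems.SignConeOscillatory.Negative.SlackUnbounded
import Summits.RiemannHypothesis.RiemannHypothesis.Theorems.SignConeSignConeOscillatoryCoherentCoreCollapse

/-!
# `OscCoherentCore` (crux stmt-RiemannHypothesis-18013) — negative lemma: the node signs stay load-bearing on the
# coherent-core class, and no slack replaces them
(route `SignCone`; refuter crux-attack record of the standing disprover, `--supports` — it closes nothing)

The crux `Summit.RiemannHypothesis.RiemannHypothesis.Theses.SignCone.OscCoherentCore` is the unit-slack sign-cone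
inequality `-Re F(0) ≤ Re W_ar(F)` (`W_ar = weilPolarTerm + weilArchTerm`, spelled over Mathlib primitives in the
item) for node-nonnegative autocorrelation sums `F = Σᵢ gᵢ ⋆ g̃ᵢ` at cutoffs `a > 13/10` whose far-field negativity is
NOT confined to a single window `T ≤ |t| ≤ T + log 2`, `T ≥ 3` (the "coherent core": negativity below height `3`, or
spread over more than one octave). It is RH-implied and in fact equivalent to the whole oscillatory crux
(`SignCone.oscCoherentCore_iff_signConeOscillatory`, landed), so no refutation exists short of `¬RH`. This file records
which hypothesis carries the content INSIDE the coherent-core class: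

* `oscCoherentCore_false_without_nodeNonneg_anySlack` — delete the node hypothesis `∀ n ≥ 2, 0 ≤ Re F(log n)` from the
  item and replace the unit slack `-Re F(0)` by `-C · Re F(0)` for an ARBITRARY real `C` (cutoff guard `13/10 < a`,
  the "not a single window" hypothesis, the oscillation hypothesis and the cone structure kept verbatim): FALSE for
  every `C`.
* `oscCoherentCore_false_without_nodeNonneg` — the case `C = 1`: the item with its node hypothesis deleted, verbatim.

Witness (`k = 2`): `g = (w_c, η · w_{c+4})` with the two-bump tests `w_c = φ(· + c/2) - φ(· - c/2)`,
`φ = WeilContinuous.moll 0` (radius `1`), `c ≥ 4` the polar-dominating height of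
`SignConeOscillatory.Negative.exists_twoBump_re_weilArchPolar_lt C` (`Re W_ar(w_c ⋆ w̃_c) < -C·Re (w_c ⋆ w̃_c)(0)`:
polar term `-8 sinh²(c/4) φ̂(0) φ̂(1)` against a `c`-free archimedean bound), cutoff `a = c/2 + 3`. The autocorrelation
sum `G_c + η² G_{c+4}` is negative at `c` AND at `c + 4` (each two-bump autocorrelation vanishes at the other height),
two heights more than `log 2` apart, so it lies in NO single window — it is in the coherent-core class for every
`η > 0`; linearity of `W_ar` and `η → 0` transfer the polar domination of `G_c` to the mutated statement.

Reading for provers: the class restriction of the core ("not a single window", `a > 13/10`) does not interact with the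
node signs at all — exactly as for the parent crux (`SignConeOscillatory.Negative.WithoutNodeNonneg`,
`…SlackUnbounded`) and for the sibling `OscSingleWindow.Negative.WithoutNodeNonneg`, the prime-free functional is
unbounded below relative to `F(0)` on the hn-free cone, and any proof must consume `Re F(log n) ≥ 0` (by the parent's
numerics, at the first few primes).
-/

noncomputable section

-- `Summit.RiemannHypothesis.RiemannHypothesis.…` repeats a namespace component by design (D-0017 layout).
set_option linter.dupNamespace false

open scoped BigOperators ComplexConjugate Topology
open Complex MeasureTheory Set Filter

namespace Summit.RiemannHypothesis.RiemannHypothesis.Theorems.OscCoherentCore.Negative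

open Literature.NumberTheory.LFunctions
open Summit.RiemannHypothesis.RiemannHypothesis.Theorems.SignCone
open Summit.RiemannHypothesis.RiemannHypothesis.Theorems.SignConeOscillatory.Negative

/-- **Without the node signs no slack suffices, even inside the coherent-core class.** For every `C : ℝ`, the crux
`OscCoherentCore` with its node hypothesis `∀ n ≥ 2, 0 ≤ Re F(log n)` deleted and the unit slack `-Re F(0)` of its
conclusion replaced by `-C·Re F(0)` (cutoff guard, "not a single window", oscillation and cone structure verbatim) is
false. Witness `k = 2`, `g = (w_c, η w_{c+4})` (two-bump tests of radius `1`, `c ≥ 4` from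
`exists_twoBump_re_weilArchPolar_lt C`), cutoff `a = c/2 + 3`, `η → 0`. [folklore] -/
theorem oscCoherentCore_false_without_nodeNonneg_anySlack (C : ℝ) :
    ¬ (∀ a : ℝ, 0 < a → 13 / 10 < a → ∀ (k : ℕ) (g : Fin k → ℝ → ℂ), (∀ i, (ContDiff ℝ ((⊤ : ℕ∞) : WithTop ℕ∞) (g i) ∧ HasCompactSupport (g i)) ∧ tsupport (g i) ⊆ Set.Icc (-a) a) → let F : ℝ → ℂ := fun t => ∑ i, MeasureTheory.convolution (g i) (fun u => (starRingEnd ℂ) ((g i) (-u))) (ContinuousLinearMap.mul ℂ ℂ) MeasureTheory.MeasureSpace.volume t; ¬ (∃ T : ℝ, 3 ≤ T ∧ ∀ t : ℝ, Real.log 2 ≤ |t| → (F t).re < 0 → T ≤ |t| ∧ |t| ≤ T + Real.log 2) → (∃ t : ℝ, Real.log 2 ≤ |t| ∧ (F t).re < 0) → let M : ℂ → ℂ := fun s => ∫ u : ℝ, F u * Complex.exp ((s - 1 / 2) * u); -(C * (F 0).re) ≤ (M 0 + M 1 + ((1 / (2 * Real.pi) : ℂ) * (∫ t : ℝ, M (1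 / 2 + t * Complex.I) * ((Complex.digamma (1 / 4 + t / 2 * Complex.I)).re : ℂ)) - F 0 * (Real.log Real.pi : ℂ))).re) := by
  intro h
  obtain ⟨c, hc4, hlt⟩ := exists_twoBump_re_weilArchPolar_lt C
  have hρ : (WeilContinuous.bump 0).rOut = 1 := by rw [WeilContinuous.bump_rOut]; norm_num
  have hlog2 := Real.log_two_lt_d9
  have hc0 : 0 ≤ c := by linarith
  -- the polar-dominating two-bump at height `c`
  set w : ℝ → ℂ := fun u => WeilContinuous.moll 0 (u + c / 2) - WeilContinuous.moll 0 (u - c / 2) with hw_def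
  have hw : IsWeilTest w := isWeilTest_twoBump 0 c
  set G : ℝ → ℂ := weilConv w (weilReflect w) with hG_def
  have hGt : IsWeilTest G := hw.weilConv hw.weilReflect
  -- a second two-bump at height `c' = c + 4`, breaking every single window
  set c' : ℝ := c + 4 with hc'_def
  have hc'0 : 0 ≤ c' := by rw [hc'_def]; linarith
  set w' : ℝ → ℂ := fun u => WeilContinuous.moll 0 (u + c' / 2) - WeilContinuous.moll 0 (u - c' / 2) with hw'_def
  have hw' : IsWeilTest w' := isWeilTest_twoBump 0 c'
  set G' : ℝ → ℂ := weilConv w' (weilReflect w') with hG'_def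
  have hG't : IsWeilTest G' := hw'.weilConv hw'.weilReflect
  -- values at `c` and `c'`
  have hGc : (G c).re < 0 := re_weilConv_twoBump_neg 0 (by rw [hρ]; linarith)
  have hG'c' : (G' c').re < 0 := re_weilConv_twoBump_neg 0 (by rw [hρ, hc'_def]; linarith)
  have hGc' : G c' = 0 := by
    refine weilConv_twoBump_eq_zero 0 hc0 (by rw [hρ, hc'_def]; linarith) ?_
    rw [hρ, hc'_def, show c + 4 - c = (4 : ℝ) by ring, abs_of_pos (by norm_num : (0 : ℝ) < 4)]
    norm_num
  have hG'c : G' c = 0 := by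
    refine weilConv_twoBump_eq_zero 0 hc'0 (by rw [hρ]; linarith) ?_
    rw [hρ, hc'_def, show c - (c + 4) = (-4 : ℝ) by ring, abs_of_neg (by norm_num : (-4 : ℝ) < 0)]
    norm_num
  -- the cutoff `a = c'/2 + 1 = c/2 + 3 > 13/10`
  set a : ℝ := c' / 2 + 1 with ha_def
  have ha : 0 < a := by rw [ha_def, hc'_def]; linarith
  have ha13 : 13 / 10 < a := by rw [ha_def, hc'_def]; linarith
  have hwsupp : tsupport w ⊆ Icc (-a) a := by
    have := tsupport_twoBump_subset 0 (c := c) hc0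
    rw [hρ] at this
    exact this.trans (Icc_subset_Icc (by rw [ha_def, hc'_def]; linarith) (by rw [ha_def, hc'_def]; linarith))
  have hw'supp : tsupport w' ⊆ Icc (-a) a := by
    have := tsupport_twoBump_subset 0 (c := c') hc'0
    rw [hρ] at this
    exact this
  have habs : Real.log 2 ≤ |c| := by rw [abs_of_nonneg hc0]; linarith
  have habs' : Real.log 2 ≤ |c'| := by rw [abs_of_nonneg hc'0, hc'_def]; linarith
  -- the key inequality for every `η > 0`
  have key : ∀ η : ℝ, 0 < η →
      -(C * (G 0).re) ≤ (weilPolarTerm G + weilArchTerm G).re +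
        η ^ 2 * ((weilPolarTerm G' + weilArchTerm G').re + C * (G' 0).re) := by
    intro η hη
    -- the family `g₂ = (w, η w')`
    set g₁ : Fin 1 → ℝ → ℂ := fun _ => w with hg₁_def
    set v : ℝ → ℂ := fun u => (η : ℂ) * w' u with hv_def
    have hvt : IsWeilTest v := hw'.const_mul (η : ℂ)
    have hvsupp : tsupport v ⊆ Icc (-a) a := tsupport_mul_subset_right.trans hw'supp
    set g₂ : Fin (1 + 1) → ℝ → ℂ := Fin.snoc (α := fun _ => ℝ → ℂ) g₁ v with hg₂_def
    have hg₁ : ∀ i, (ContDiff ℝ ((⊤ : ℕ∞) : WithTop ℕ∞) (g₁ i) ∧ HasCompactSupport (g₁ i)) ∧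
        tsupport (g₁ i) ⊆ Set.Icc (-a) a := fun _ => ⟨hw, hwsupp⟩
    have hg₂ : ∀ i, (ContDiff ℝ ((⊤ : ℕ∞) : WithTop ℕ∞) (g₂ i) ∧ HasCompactSupport (g₂ i)) ∧
        tsupport (g₂ i) ⊆ Set.Icc (-a) a :=
      snoc_family_isWeilTest_tsupport le_rfl hg₁ hvt hvsupp
    -- its autocorrelation sum is `G + η² G'`
    have hsum₁ : ∀ t, (∑ i, weilConv (g₁ i) (weilReflect (g₁ i)) t) = G t := by
      intro t
      simp [hg₁_def, hG_def]
    have hF₂t : ∀ t, ∑ i, weilConv (g₂ i) (weilReflect (g₂ i)) t = G t + ((η ^ 2 : ℝ) : ℂ) * G' t := by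
      intro t
      rw [hg₂_def, hv_def, sum_weilConv_snoc_const_mul_apply, hsum₁]
    have hF₂ : (fun t => ∑ i, weilConv (g₂ i) (weilReflect (g₂ i)) t) =
        fun t => G t + ((η ^ 2 : ℝ) : ℂ) * G' t := funext hF₂t
    -- negative at `c` and at `c'`
    have hre : ((fun t => ∑ i, weilConv (g₂ i) (weilReflect (g₂ i)) t) c).re < 0 := by
      show (∑ i, weilConv (g₂ i) (weilReflect (g₂ i)) c).re < 0
      rw [hF₂t, hG'c, mul_zero, add_zero]
      exact hGc
    have hre' : ((fun t => ∑ i, weilConv (g₂ i) (weilReflect (g₂ i)) t) c').re < 0 := by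
      show (∑ i, weilConv (g₂ i) (weilReflect (g₂ i)) c').re < 0
      rw [hF₂t, hGc', zero_add, Complex.re_ofReal_mul]
      exact mul_neg_of_pos_of_neg (pow_pos hη 2) hG'c'
    -- oscillation, and NOT a single window (`c' - c = 4 > log 2`)
    have hosc : ∃ t : ℝ, Real.log 2 ≤ |t| ∧
        ((fun t => ∑ i, weilConv (g₂ i) (weilReflect (g₂ i)) t) t).re < 0 := ⟨c, habs, hre⟩
    have hnw : ¬ ∃ T : ℝ, 3 ≤ T ∧ ∀ t : ℝ, Real.log 2 ≤ |t| →
        ((fun t => ∑ i, weilConv (g₂ i) (weilReflect (g₂ i)) t) t).re < 0 →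
          T ≤ |t| ∧ |t| ≤ T + Real.log 2 := by
      rintro ⟨T, -, hT⟩
      have h₁ := hT c habs hre
      have h₂ := hT c' habs' hre'
      rw [abs_of_nonneg hc0] at h₁
      rw [abs_of_nonneg hc'0, hc'_def] at h₂
      linarith [h₁.1, h₂.2]
    -- the mutated statement at the witness, in the Literature vocabulary (definitional unfolding)
    have step : -(C * ((fun t => ∑ i, weilConv (g₂ i) (weilReflect (g₂ i)) t) 0).re) ≤
        (weilPolarTerm (fun t => ∑ i, weilConv (g₂ i) (weilReflect (g₂ i)) t) +
          weilArchTerm (fun t => ∑ i, weilConv (g₂ i) (weilReflect (g₂ i)) t)).re :=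
      h a ha ha13 (1 + 1) g₂ hg₂ hnw hosc
    rw [hF₂, weilArchPolar_add_const_mul hGt hG't] at step
    simp only [Complex.add_re, Complex.re_ofReal_mul] at step
    simp only [Complex.add_re]
    linear_combination step
  have hmain : -(C * (G 0).re) ≤ (weilPolarTerm G + weilArchTerm G).re := le_of_forall_pos_le_add_sq_mul key
  exact absurd hmain (not_le.2 hlt)

/-- **Node non-negativity is load-bearing for `OscCoherentCore`.** The crux with its node hypothesis
`∀ n ≥ 2, 0 ≤ Re F(log n)` deleted (everything else verbatim: cutoff guard `13/10 < a`, cone structure, "not a single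
window", oscillation, unit slack) is false — the case `C = 1` of
`oscCoherentCore_false_without_nodeNonneg_anySlack`. [folklore] -/
theorem oscCoherentCore_false_without_nodeNonneg :
    ¬ (∀ a : ℝ, 0 < a → 13 / 10 < a → ∀ (k : ℕ) (g : Fin k → ℝ → ℂ), (∀ i, (ContDiff ℝ ((⊤ : ℕ∞) : WithTop ℕ∞) (g i) ∧ HasCompactSupport (g i)) ∧ tsupport (g i) ⊆ Set.Icc (-a) a) → let F : ℝ → ℂ := fun t => ∑ i, MeasureTheory.convolution (g i) (fun u => (starRingEnd ℂ) ((g i) (-u))) (ContinuousLinearMap.mul ℂ ℂ) MeasureTheory.MeasureSpace.volume t; ¬ (∃ T : ℝ, 3 ≤ T ∧ ∀ t : ℝ, Real.log 2 ≤ |t| → (F t).re < 0 → T ≤ |t| ∧ |t| ≤ T + Real.log 2) → (∃ t : ℝ, Real.log 2 ≤ |t| ∧ (F t).re < 0) → let M : ℂ → ℂ := fun s => ∫ u : ℝ, F u * Complex.exp ((s - 1 / 2) * u); -(F 0).re ≤ (M 0 + M 1 + ((1 / (2 * Real.pi) : ℂ) * (∫ t : ℝ, M (1 / 2 + t * Complex.I)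 * ((Complex.digamma (1 / 4 + t / 2 * Complex.I)).re : ℂ)) - F 0 * (Real.log Real.pi : ℂ))).re) := by
  intro h
  refine oscCoherentCore_false_without_nodeNonneg_anySlack 1 ?_
  intro a ha ha13 k g hg F hnw hosc M
  have := h a ha ha13 k g hg hnw hosc
  simpa only [one_mul] using this

end Summit.RiemannHypothesis.RiemannHypothesis.Theorems.OscCoherentCore.Negative

end
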